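import Mathlib.Tactic.Ring
import Mathlib.Tactic.Linarith
import Mathlib.Tactic.LinearCombination
import Mathlib.Data.Real.Basic
import HarnessLib

/-!
# Conjecture N (hodge-weil ladder, GAPS G51b), format (5,3): the VERTEX GAUGE and the P1-RELAXATION set-up

Prover 2, generation 21 (note `run/shared/lean/b2b/hodge-weil/b2b-hweil-pv2-g21/RELAXATION-G21.md`). Setting of `CONJECTURE-N.md` §1, format (5,3),
real charges, centred coordinates: E-roots `(A_e, u_e)`, F-roots `(B_g, v_g)`, `hA : ΣA = ΣB`, `hC : Σu = Σv`; `S = Σu² − Σv²`, walls `w(x) = x² − S/2`;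
`Q₂ = ½ S_A S + S_{Au}² − 3 S_{A²u²}`, `Q₄ = 3 Σε u⁴ − (3/2) S²`, purity sums `P1 = Σε A²u`, `P2 = Σε A u²`, `P4 = Σε u³`.
THE VERTEX GAUGE (format-(5,3) form of generation 12's `WeilClassTestVertexGauge`): for ANY level `As` put heights `H_e = A_e − As` (E), `H_g = As − B_g` (F)
(all `≥ 0` iff the level separates F from E), `T = ΣH` (`= −2·As` by `hA`), `Mo = Σ_E u_e H_e + Σ_F v_g H_g` (`= S_{Au}`), `W = Σ_E w(u_e)H_e + Σ_F w(v_g)H_g`.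
Identities (pure algebra; `ring` / `linear_combination`):
* `Q4_eq_walls_53` : `Q₄ = 3(Σ_E w(u_e)² − Σ_F w(v_g)²)` (no hypothesis);
* `P2_vertex_gauge_53` : `P2 = W` (given `hA`);  `P1_vertex_gauge_53` : `P1 = Σ_E u_e H_e² − Σ_F v_g H_g² − T·Mo` (given `hA`, `hC`);
* `Q2_vertex_gauge_53` : `Q₂ = Mo² + (S/2)·T² + 3·T·W − (Σ_E (3w(u_e)+S)H_e² − Σ_F (3w(v_g)+S)H_g²)` (given `hA`, `hC`) — so ON THE PURE LOCUS (`W = P2 = 0`)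
  `Q₂ = Mo² + (S/2)T² − Σ_k ε_k(3w_k+S)H_k²`, a diagonal-plus-rank-two quadratic form in the heights; for FIXED charges the only constraint that is not linear
  in the heights is `P1 = 0`, and pairwise ampleness reads `H_k + H_l ≥ |ch_k − ch_l|` for all pairs (1-D Helly) — the P1-RELAXATION programme of the note;
* `cross_diag_identity_53` : for any `us`, `Σ_E (3w(u_e)+S)(u_e−us)² − Σ_F (3w(v_g)+S)(v_g−us)² = Q₄ + S² + 2·S·us²` (given `hC`, `hP4`) — the diagonal term evaluated
  on a CROSS (`H_k = |ch_k − us|`) is charge-only and ABSORBS `Q₄`;  `cross_P1_value_53` : `Σ_E u_e(u_e−us)² − Σ_F v_g(v_g−us)² = −2·us·S`;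
* `G_on_cross_53` : on a cross through `(As, us)` (`H_e² = (u_e−us)²`, `H_g² = (v_g−us)²`) with `P2 = 0`:  `Q₂ + Q₄ = Mo² + (S/2)T² − S² − 2·S·us²`
  — Conjecture N on crosses (generation 9's null-cone theorem) is thus the charge inequality `Mo² + (S/2)T² ≥ S² + 2S·us²` (note §3, 'cross lemma').
Nothing here is a case of HC, a rung or a door edge; no statement of Markman's papers is used. New cell result ⇒ Summits/.
-/

set_option linter.dupNamespace false

namespace Summit.HodgeConjecture.HodgeConjecture.WeilClassTestFormatFiveThreeVertexGauge

/-- `Q₄ = 3·Σ_k ε_k w_k²` with `w_k = ch_k² − S/2` (format (5,3); an identity — only `|E| − |F| = 2` enters). -/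
theorem Q4_eq_walls_53 (u₁ u₂ u₃ u₄ u₅ v₁ v₂ v₃ : ℝ) :
    3 * ((u₁ ^ 4 + u₂ ^ 4 + u₃ ^ 4 + u₄ ^ 4 + u₅ ^ 4) - (v₁ ^ 4 + v₂ ^ 4 + v₃ ^ 4)) - (3 / 2) * ((u₁ ^ 2 + u₂ ^ 2 + u₃ ^ 2 + u₄ ^ 2 + u₅ ^ 2) - (v₁ ^ 2 + v₂ ^ 2 + v₃ ^ 2)) ^ 2
      = 3 * (((u₁ ^ 2 - ((u₁ ^ 2 + u₂ ^ 2 + u₃ ^ 2 + u₄ ^ 2 + u₅ ^ 2) - (v₁ ^ 2 + v₂ ^ 2 + v₃ ^ 2)) / 2) ^ 2 + (u₂ ^ 2 - ((u₁ ^ 2 + u₂ ^ 2 + u₃ ^ 2 + u₄ ^ 2 + u₅ ^ 2) - (v₁ ^ 2 + v₂ ^ 2 + v₃ ^ 2)) / 2) ^ 2 + (u₃ ^ 2 - ((u₁ ^ 2 + u₂ ^ 2 + u₃ ^ 2 + u₄ ^ 2 + u₅ ^ 2) - (v₁ ^ 2 + v₂ ^ 2 + v₃ ^ 2)) / 2)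 ^ 2 + (u₄ ^ 2 - ((u₁ ^ 2 + u₂ ^ 2 + u₃ ^ 2 + u₄ ^ 2 + u₅ ^ 2) - (v₁ ^ 2 + v₂ ^ 2 + v₃ ^ 2)) / 2) ^ 2 + (u₅ ^ 2 - ((u₁ ^ 2 + u₂ ^ 2 + u₃ ^ 2 + u₄ ^ 2 + u₅ ^ 2) - (v₁ ^ 2 + v₂ ^ 2 + v₃ ^ 2)) / 2) ^ 2) - ((v₁ ^ 2 - ((u₁ ^ 2 + u₂ ^ 2 + u₃ ^ 2 + u₄ ^ 2 + u₅ ^ 2) - (v₁ ^ 2 + v₂ ^ 2 + v₃ ^ 2)) / 2) ^ 2 + (v₂ ^ 2 - ((u₁ ^ 2 + u₂ ^ 2 + u₃ ^ 2 + u₄ ^ 2 + u₅ ^ 2) - (v₁ ^ 2 + v₂ ^ 2 + v₃ ^ 2)) / 2) ^ 2 + (v₃ ^ 2 - ((u₁ ^ 2 + u₂ ^ 2 + u₃ ^ 2 + u₄ ^ 2 + u₅ ^ 2) - (v₁ ^ 2 + v₂ ^ 2 + v₃ ^ 2)) / 2) ^ 2)) := by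
  ring

/-- Total height: `T = ΣA − ΣB − 2·As`, i.e. `T = −2·As` for centred positions. -/
theorem T_vertex_gauge_53 (A₁ A₂ A₃ A₄ A₅ B₁ B₂ B₃ As : ℝ)
    (hA : A₁ + A₂ + A₃ + A₄ + A₅ = B₁ + B₂ + B₃) :
    ((A₁ - As) + (A₂ - As) + (A₃ - As) + (A₄ - As) + (A₅ - As) + (As - B₁) + (As - B₂) + (As - B₃)) = -2 * As := by
  linear_combination hA

/-- `P2 = W := Σ_E w(u_e)·H_e + Σ_F w(v_g)·H_g` in the vertex gauge (centred positions; `Σ_k ε_k w_k = 0` identically). -/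
theorem P2_vertex_gauge_53 (A₁ A₂ A₃ A₄ A₅ B₁ B₂ B₃ u₁ u₂ u₃ u₄ u₅ v₁ v₂ v₃ As : ℝ)
    (hA : A₁ + A₂ + A₃ + A₄ + A₅ = B₁ + B₂ + B₃) :
    ((A₁ * u₁ ^ 2 + A₂ * u₂ ^ 2 + A₃ * u₃ ^ 2 + A₄ * u₄ ^ 2 + A₅ * u₅ ^ 2) - (B₁ * v₁ ^ 2 + B₂ * v₂ ^ 2 + B₃ * v₃ ^ 2))
      = ((u₁ ^ 2 - ((u₁ ^ 2 + u₂ ^ 2 + u₃ ^ 2 + u₄ ^ 2 + u₅ ^ 2) - (v₁ ^ 2 + v₂ ^ 2 + v₃ ^ 2)) / 2) * (A₁ - As) + (u₂ ^ 2 - ((u₁ ^ 2 + u₂ ^ 2 + u₃ ^ 2 + u₄ ^ 2 + u₅ ^ 2) - (v₁ ^ 2 + v₂ ^ 2 + v₃ ^ 2)) / 2) * (A₂ - As) + (u₃ ^ 2 - ((u₁ ^ 2 + u₂ ^ 2 + u₃ ^ 2 + u₄ ^ 2 + u₅ ^ 2) - (v₁ ^ 2 + v₂ ^ 2 + v₃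 ^ 2)) / 2) * (A₃ - As) + (u₄ ^ 2 - ((u₁ ^ 2 + u₂ ^ 2 + u₃ ^ 2 + u₄ ^ 2 + u₅ ^ 2) - (v₁ ^ 2 + v₂ ^ 2 + v₃ ^ 2)) / 2) * (A₄ - As) + (u₅ ^ 2 - ((u₁ ^ 2 + u₂ ^ 2 + u₃ ^ 2 + u₄ ^ 2 + u₅ ^ 2) - (v₁ ^ 2 + v₂ ^ 2 + v₃ ^ 2)) / 2) * (A₅ - As) + (v₁ ^ 2 - ((u₁ ^ 2 + u₂ ^ 2 + u₃ ^ 2 + u₄ ^ 2 + u₅ ^ 2) - (v₁ ^ 2 + v₂ ^ 2 + v₃ ^ 2)) / 2) * (As - B₁) + (v₂ ^ 2 - ((u₁ ^ 2 + u₂ ^ 2 + u₃ ^ 2 + u₄ ^ 2 + u₅ ^ 2) - (v₁ ^ 2 + v₂ ^ 2 + v₃ ^ 2)) / 2) * (As - B₂) + (v₃ ^ 2 - ((u₁ ^ 2 + u₂ ^ 2 + u₃ ^ 2 + u₄ ^ 2 + u₅ ^ 2) - (v₁ ^ 2 + v₂ ^ 2 + v₃ ^ 2)) / 2) * (As - B₃))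 := by
  linear_combination (((u₁ ^ 2 + u₂ ^ 2 + u₃ ^ 2 + u₄ ^ 2 + u₅ ^ 2) - (v₁ ^ 2 + v₂ ^ 2 + v₃ ^ 2)) / 2) * hA

set_option maxHeartbeats 2000000 in
set_option maxRecDepth 16384 in
/-- `P1 = Σ_E u_e H_e² − Σ_F v_g H_g² − T·Mo` in the vertex gauge (centred positions and charges). -/
theorem P1_vertex_gauge_53 (A₁ A₂ A₃ A₄ A₅ B₁ B₂ B₃ u₁ u₂ u₃ u₄ u₅ v₁ v₂ v₃ As : ℝ)
    (hA : A₁ + A₂ + A₃ + A₄ + A₅ = B₁ + B₂ + B₃) (hC : u₁ + u₂ + u₃ + u₄ + u₅ = v₁ + v₂ + v₃) :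
    ((A₁ ^ 2 * u₁ + A₂ ^ 2 * u₂ + A₃ ^ 2 * u₃ + A₄ ^ 2 * u₄ + A₅ ^ 2 * u₅) - (B₁ ^ 2 * v₁ + B₂ ^ 2 * v₂ + B₃ ^ 2 * v₃))
      = ((u₁ * (A₁ - As) ^ 2 + u₂ * (A₂ - As) ^ 2 + u₃ * (A₃ - As) ^ 2 + u₄ * (A₄ - As) ^ 2 + u₅ * (A₅ - As) ^ 2) - (v₁ * (As - B₁) ^ 2 + v₂ * (As - B₂) ^ 2 + v₃ * (As - B₃) ^ 2))
        - ((A₁ - As) + (A₂ - As) + (A₃ - As) + (A₄ - As) + (A₅ - As) + (As - B₁) + (As - B₂) + (As - B₃))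
          * (u₁ * (A₁ - As) + u₂ * (A₂ - As) + u₃ * (A₃ - As) + u₄ * (A₄ - As) + u₅ * (A₅ - As) + v₁ * (As - B₁) + v₂ * (As - B₂) + v₃ * (As - B₃)) := by
  linear_combination (((A₁ * u₁ + A₂ * u₂ + A₃ * u₃ + A₄ * u₄ + A₅ * u₅) - (B₁ * v₁ + B₂ * v₂ + B₃ * v₃)) - As * ((u₁ + u₂ + u₃ + u₄ + u₅) - (v₁ + v₂ + v₃))) * hA + (As ^ 2) * hC

set_option maxHeartbeats 2000000 in
set_option maxRecDepth 16384 in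
/-- THE VERTEX-GAUGE FORM OF `Q₂` (centred positions and charges, any level `As`):
`Q₂ = Mo² + (S/2)·T² + 3·T·W − (Σ_E (3w(u_e)+S)·H_e² − Σ_F (3w(v_g)+S)·H_g²)`; on the pure locus `W = P2 = 0`. -/
theorem Q2_vertex_gauge_53 (A₁ A₂ A₃ A₄ A₅ B₁ B₂ B₃ u₁ u₂ u₃ u₄ u₅ v₁ v₂ v₃ As : ℝ)
    (hA : A₁ + A₂ + A₃ + A₄ + A₅ = B₁ + B₂ + B₃) (hC : u₁ + u₂ + u₃ + u₄ + u₅ = v₁ + v₂ + v₃) :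
    (1 / 2) * ((A₁ ^ 2 + A₂ ^ 2 + A₃ ^ 2 + A₄ ^ 2 + A₅ ^ 2) - (B₁ ^ 2 + B₂ ^ 2 + B₃ ^ 2)) * ((u₁ ^ 2 + u₂ ^ 2 + u₃ ^ 2 + u₄ ^ 2 + u₅ ^ 2) - (v₁ ^ 2 + v₂ ^ 2 + v₃ ^ 2))
        + ((A₁ * u₁ + A₂ * u₂ + A₃ * u₃ + A₄ * u₄ + A₅ * u₅) - (B₁ * v₁ + B₂ * v₂ + B₃ * v₃)) ^ 2
        - 3 * ((A₁ ^ 2 * u₁ ^ 2 + A₂ ^ 2 * u₂ ^ 2 + A₃ ^ 2 * u₃ ^ 2 + A₄ ^ 2 * u₄ ^ 2 + A₅ ^ 2 * u₅ ^ 2) - (B₁ ^ 2 * v₁ ^ 2 + B₂ ^ 2 * v₂ ^ 2 + B₃ ^ 2 * v₃ ^ 2))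
      = (u₁ * (A₁ - As) + u₂ * (A₂ - As) + u₃ * (A₃ - As) + u₄ * (A₄ - As) + u₅ * (A₅ - As) + v₁ * (As - B₁) + v₂ * (As - B₂) + v₃ * (As - B₃)) ^ 2
        + (((u₁ ^ 2 + u₂ ^ 2 + u₃ ^ 2 + u₄ ^ 2 + u₅ ^ 2) - (v₁ ^ 2 + v₂ ^ 2 + v₃ ^ 2)) / 2) * ((A₁ - As) + (A₂ - As) + (A₃ - As) + (A₄ - As) + (A₅ - As) + (As - B₁) + (As - B₂) + (As - B₃)) ^ 2
        + 3 * ((A₁ - As) + (A₂ - As) + (A₃ - As) + (A₄ - As) + (A₅ - As) + (As - B₁) + (As - B₂) + (As - B₃))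
          * ((u₁ ^ 2 - ((u₁ ^ 2 + u₂ ^ 2 + u₃ ^ 2 + u₄ ^ 2 + u₅ ^ 2) - (v₁ ^ 2 + v₂ ^ 2 + v₃ ^ 2)) / 2) * (A₁ - As) + (u₂ ^ 2 - ((u₁ ^ 2 + u₂ ^ 2 + u₃ ^ 2 + u₄ ^ 2 + u₅ ^ 2) - (v₁ ^ 2 + v₂ ^ 2 + v₃ ^ 2)) / 2) * (A₂ - As) + (u₃ ^ 2 - ((u₁ ^ 2 + u₂ ^ 2 + u₃ ^ 2 + u₄ ^ 2 + u₅ ^ 2) - (v₁ ^ 2 + v₂ ^ 2 + v₃ ^ 2)) / 2) * (A₃ - As) + (u₄ ^ 2 - ((u₁ ^ 2 + u₂ ^ 2 + u₃ ^ 2 + u₄ ^ 2 + u₅ ^ 2) - (v₁ ^ 2 + v₂ ^ 2 + v₃ ^ 2)) / 2) * (A₄ - As) + (u₅ ^ 2 - ((u₁ ^ 2 + u₂ ^ 2 + u₃ ^ 2 + u₄ ^ 2 + u₅ ^ 2) - (v₁ ^ 2 + v₂ ^ 2 + v₃ ^ 2)) / 2) * (A₅ - As) + (v₁ ^ 2 -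 ((u₁ ^ 2 + u₂ ^ 2 + u₃ ^ 2 + u₄ ^ 2 + u₅ ^ 2) - (v₁ ^ 2 + v₂ ^ 2 + v₃ ^ 2)) / 2) * (As - B₁) + (v₂ ^ 2 - ((u₁ ^ 2 + u₂ ^ 2 + u₃ ^ 2 + u₄ ^ 2 + u₅ ^ 2) - (v₁ ^ 2 + v₂ ^ 2 + v₃ ^ 2)) / 2) * (As - B₂) + (v₃ ^ 2 - ((u₁ ^ 2 + u₂ ^ 2 + u₃ ^ 2 + u₄ ^ 2 + u₅ ^ 2) - (v₁ ^ 2 + v₂ ^ 2 + v₃ ^ 2)) / 2) * (As - B₃))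
        - (((3 * (u₁ ^ 2 - ((u₁ ^ 2 + u₂ ^ 2 + u₃ ^ 2 + u₄ ^ 2 + u₅ ^ 2) - (v₁ ^ 2 + v₂ ^ 2 + v₃ ^ 2)) / 2) + ((u₁ ^ 2 + u₂ ^ 2 + u₃ ^ 2 + u₄ ^ 2 + u₅ ^ 2) - (v₁ ^ 2 + v₂ ^ 2 + v₃ ^ 2))) * (A₁ - As) ^ 2 + (3 * (u₂ ^ 2 - ((u₁ ^ 2 + u₂ ^ 2 + u₃ ^ 2 + u₄ ^ 2 + u₅ ^ 2) - (v₁ ^ 2 + v₂ ^ 2 + v₃ ^ 2)) / 2) + ((u₁ ^ 2 + u₂ ^ 2 + u₃ ^ 2 + u₄ ^ 2 + u₅ ^ 2) - (v₁ ^ 2 + v₂ ^ 2 + v₃ ^ 2))) * (A₂ - As) ^ 2 + (3 * (u₃ ^ 2 - ((u₁ ^ 2 + u₂ ^ 2 + u₃ ^ 2 + u₄ ^ 2 + u₅ ^ 2) - (v₁ ^ 2 + v₂ ^ 2 + v₃ ^ 2)) / 2) + ((u₁ ^ 2 + u₂ ^ 2 + u₃ ^ 2 + u₄ ^ 2 +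 u₅ ^ 2) - (v₁ ^ 2 + v₂ ^ 2 + v₃ ^ 2))) * (A₃ - As) ^ 2 + (3 * (u₄ ^ 2 - ((u₁ ^ 2 + u₂ ^ 2 + u₃ ^ 2 + u₄ ^ 2 + u₅ ^ 2) - (v₁ ^ 2 + v₂ ^ 2 + v₃ ^ 2)) / 2) + ((u₁ ^ 2 + u₂ ^ 2 + u₃ ^ 2 + u₄ ^ 2 + u₅ ^ 2) - (v₁ ^ 2 + v₂ ^ 2 + v₃ ^ 2))) * (A₄ - As) ^ 2 + (3 * (u₅ ^ 2 - ((u₁ ^ 2 + u₂ ^ 2 + u₃ ^ 2 + u₄ ^ 2 + u₅ ^ 2) - (v₁ ^ 2 + v₂ ^ 2 + v₃ ^ 2)) / 2) + ((u₁ ^ 2 + u₂ ^ 2 + u₃ ^ 2 + u₄ ^ 2 + u₅ ^ 2) - (v₁ ^ 2 + v₂ ^ 2 + v₃ ^ 2))) * (A₅ - As) ^ 2) - ((3 * (v₁ ^ 2 - ((u₁ ^ 2 + u₂ ^ 2 + u₃ ^ 2 + u₄ ^ 2 + u₅ ^ 2) - (v₁ ^ 2 + v₂ ^ 2 + v₃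 ^ 2)) / 2) + ((u₁ ^ 2 + u₂ ^ 2 + u₃ ^ 2 + u₄ ^ 2 + u₅ ^ 2) - (v₁ ^ 2 + v₂ ^ 2 + v₃ ^ 2))) * (As - B₁) ^ 2 + (3 * (v₂ ^ 2 - ((u₁ ^ 2 + u₂ ^ 2 + u₃ ^ 2 + u₄ ^ 2 + u₅ ^ 2) - (v₁ ^ 2 + v₂ ^ 2 + v₃ ^ 2)) / 2) + ((u₁ ^ 2 + u₂ ^ 2 + u₃ ^ 2 + u₄ ^ 2 + u₅ ^ 2) - (v₁ ^ 2 + v₂ ^ 2 + v₃ ^ 2))) * (As - B₂) ^ 2 + (3 * (v₃ ^ 2 - ((u₁ ^ 2 + u₂ ^ 2 + u₃ ^ 2 + u₄ ^ 2 + u₅ ^ 2) - (v₁ ^ 2 + v₂ ^ 2 + v₃ ^ 2)) / 2) + ((u₁ ^ 2 + u₂ ^ 2 + u₃ ^ 2 + u₄ ^ 2 + u₅ ^ 2) - (v₁ ^ 2 + v₂ ^ 2 + v₃ ^ 2))) * (As - B₃) ^ 2)) := by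
  linear_combination (((u₁ ^ 2 + u₂ ^ 2 + u₃ ^ 2 + u₄ ^ 2 + u₅ ^ 2) - (v₁ ^ 2 + v₂ ^ 2 + v₃ ^ 2)) * ((A₁ + A₂ + A₃ + A₄ + A₅) - (B₁ + B₂ + B₃)) - 3 * ((A₁ * u₁ ^ 2 + A₂ * u₂ ^ 2 + A₃ * u₃ ^ 2 + A₄ * u₄ ^ 2 + A₅ * u₅ ^ 2) - (B₁ * v₁ ^ 2 + B₂ * v₂ ^ 2 + B₃ * v₃ ^ 2))) * hA + (2 * As * ((A₁ * u₁ + A₂ * u₂ + A₃ * u₃ + A₄ * u₄ + A₅ * u₅) - (B₁ * v₁ + B₂ * v₂ + B₃ * v₃)) - As ^ 2 * ((u₁ + u₂ + u₃ + u₄ + u₅) - (v₁ + v₂ + v₃))) * hC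

set_option maxHeartbeats 2000000 in
set_option maxRecDepth 16384 in
/-- CROSS DIAGONAL IDENTITY: for any vertex charge `us`, `Σ_E (3w(u_e)+S)(u_e−us)² − Σ_F (3w(v_g)+S)(v_g−us)² = Q₄ + S² + 2·S·us²`
(centred charges with `P4 = 0`): on a cross the diagonal term of `Q2_vertex_gauge_53` is charge-only and absorbs `Q₄`. -/
theorem cross_diag_identity_53 (u₁ u₂ u₃ u₄ u₅ v₁ v₂ v₃ us : ℝ)
    (hC : u₁ + u₂ + u₃ + u₄ + u₅ = v₁ + v₂ + v₃)
    (hP4 : ((u₁ ^ 3 + u₂ ^ 3 + u₃ ^ 3 + u₄ ^ 3 + u₅ ^ 3) - (v₁ ^ 3 + v₂ ^ 3 + v₃ ^ 3)) = 0) :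
    (((3 * (u₁ ^ 2 - ((u₁ ^ 2 + u₂ ^ 2 + u₃ ^ 2 + u₄ ^ 2 + u₅ ^ 2) - (v₁ ^ 2 + v₂ ^ 2 + v₃ ^ 2)) / 2) + ((u₁ ^ 2 + u₂ ^ 2 + u₃ ^ 2 + u₄ ^ 2 + u₅ ^ 2) - (v₁ ^ 2 + v₂ ^ 2 + v₃ ^ 2))) * (u₁ - us) ^ 2 + (3 * (u₂ ^ 2 - ((u₁ ^ 2 + u₂ ^ 2 + u₃ ^ 2 + u₄ ^ 2 + u₅ ^ 2) - (v₁ ^ 2 + v₂ ^ 2 + v₃ ^ 2)) / 2) + ((u₁ ^ 2 + u₂ ^ 2 + u₃ ^ 2 + u₄ ^ 2 + u₅ ^ 2) - (v₁ ^ 2 + v₂ ^ 2 + v₃ ^ 2))) * (u₂ - us) ^ 2 + (3 * (u₃ ^ 2 - ((u₁ ^ 2 + u₂ ^ 2 + u₃ ^ 2 + u₄ ^ 2 + u₅ ^ 2) - (v₁ ^ 2 + v₂ ^ 2 + v₃ ^ 2)) / 2) + ((u₁ ^ 2 + u₂ ^ 2 + u₃ ^ 2 + u₄ ^ 2 + u₅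 ^ 2) - (v₁ ^ 2 + v₂ ^ 2 + v₃ ^ 2))) * (u₃ - us) ^ 2 + (3 * (u₄ ^ 2 - ((u₁ ^ 2 + u₂ ^ 2 + u₃ ^ 2 + u₄ ^ 2 + u₅ ^ 2) - (v₁ ^ 2 + v₂ ^ 2 + v₃ ^ 2)) / 2) + ((u₁ ^ 2 + u₂ ^ 2 + u₃ ^ 2 + u₄ ^ 2 + u₅ ^ 2) - (v₁ ^ 2 + v₂ ^ 2 + v₃ ^ 2))) * (u₄ - us) ^ 2 + (3 * (u₅ ^ 2 - ((u₁ ^ 2 + u₂ ^ 2 + u₃ ^ 2 + u₄ ^ 2 + u₅ ^ 2) - (v₁ ^ 2 + v₂ ^ 2 + v₃ ^ 2)) / 2) + ((u₁ ^ 2 + u₂ ^ 2 + u₃ ^ 2 + u₄ ^ 2 + u₅ ^ 2) - (v₁ ^ 2 + v₂ ^ 2 + v₃ ^ 2))) * (u₅ - us) ^ 2) - ((3 * (v₁ ^ 2 - ((u₁ ^ 2 + u₂ ^ 2 + u₃ ^ 2 + u₄ ^ 2 + u₅ ^ 2) - (v₁ ^ 2 + v₂ ^ 2 + v₃ ^ 2))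 / 2) + ((u₁ ^ 2 + u₂ ^ 2 + u₃ ^ 2 + u₄ ^ 2 + u₅ ^ 2) - (v₁ ^ 2 + v₂ ^ 2 + v₃ ^ 2))) * (v₁ - us) ^ 2 + (3 * (v₂ ^ 2 - ((u₁ ^ 2 + u₂ ^ 2 + u₃ ^ 2 + u₄ ^ 2 + u₅ ^ 2) - (v₁ ^ 2 + v₂ ^ 2 + v₃ ^ 2)) / 2) + ((u₁ ^ 2 + u₂ ^ 2 + u₃ ^ 2 + u₄ ^ 2 + u₅ ^ 2) - (v₁ ^ 2 + v₂ ^ 2 + v₃ ^ 2))) * (v₂ - us) ^ 2 + (3 * (v₃ ^ 2 - ((u₁ ^ 2 + u₂ ^ 2 + u₃ ^ 2 + u₄ ^ 2 + u₅ ^ 2) - (v₁ ^ 2 + v₂ ^ 2 + v₃ ^ 2)) / 2) + ((u₁ ^ 2 + u₂ ^ 2 + u₃ ^ 2 + u₄ ^ 2 + u₅ ^ 2) - (v₁ ^ 2 + v₂ ^ 2 + v₃ ^ 2))) * (v₃ - us) ^ 2))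
      = 3 * ((u₁ ^ 4 + u₂ ^ 4 + u₃ ^ 4 + u₄ ^ 4 + u₅ ^ 4) - (v₁ ^ 4 + v₂ ^ 4 + v₃ ^ 4)) - (3 / 2) * ((u₁ ^ 2 + u₂ ^ 2 + u₃ ^ 2 + u₄ ^ 2 + u₅ ^ 2) - (v₁ ^ 2 + v₂ ^ 2 + v₃ ^ 2)) ^ 2
        + ((u₁ ^ 2 + u₂ ^ 2 + u₃ ^ 2 + u₄ ^ 2 + u₅ ^ 2) - (v₁ ^ 2 + v₂ ^ 2 + v₃ ^ 2)) ^ 2 + 2 * ((u₁ ^ 2 + u₂ ^ 2 + u₃ ^ 2 + u₄ ^ 2 + u₅ ^ 2) - (v₁ ^ 2 + v₂ ^ 2 + v₃ ^ 2)) * us ^ 2 := by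
  linear_combination (-(6 * us)) * hP4 + (us * ((u₁ ^ 2 + u₂ ^ 2 + u₃ ^ 2 + u₄ ^ 2 + u₅ ^ 2) - (v₁ ^ 2 + v₂ ^ 2 + v₃ ^ 2))) * hC

/-- On a cross the quadratic part of the gauge form of `P1` is charge-only: `Σ_E u_e(u_e−us)² − Σ_F v_g(v_g−us)² = −2·us·S` (centred, `P4 = 0`). -/
theorem cross_P1_value_53 (u₁ u₂ u₃ u₄ u₅ v₁ v₂ v₃ us : ℝ)
    (hC : u₁ + u₂ + u₃ + u₄ + u₅ = v₁ + v₂ + v₃)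
    (hP4 : ((u₁ ^ 3 + u₂ ^ 3 + u₃ ^ 3 + u₄ ^ 3 + u₅ ^ 3) - (v₁ ^ 3 + v₂ ^ 3 + v₃ ^ 3)) = 0) :
    ((u₁ * (u₁ - us) ^ 2 + u₂ * (u₂ - us) ^ 2 + u₃ * (u₃ - us) ^ 2 + u₄ * (u₄ - us) ^ 2 + u₅ * (u₅ - us) ^ 2) - (v₁ * (v₁ - us) ^ 2 + v₂ * (v₂ - us) ^ 2 + v₃ * (v₃ - us) ^ 2))
      = -2 * us * ((u₁ ^ 2 + u₂ ^ 2 + u₃ ^ 2 + u₄ ^ 2 + u₅ ^ 2) - (v₁ ^ 2 + v₂ ^ 2 + v₃ ^ 2)) := by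
  linear_combination hP4 + (us ^ 2) * hC

set_option maxHeartbeats 2000000 in
set_option maxRecDepth 16384 in
/-- `G = Q₂ + Q₄` ON A CROSS. If every root lies on one of the two null lines through the base point `(As, us)` — `(A_e − As)² = (u_e − us)²`,
`(As − B_g)² = (v_g − us)²` — and the configuration is centred with `P2 = 0`, `P4 = 0` (P1 is NOT needed), then
`Q₂ + Q₄ = Mo² + (S/2)·T² − S² − 2·S·us²`: Conjecture N on crosses is the charge inequality `Mo² + (S/2)T² ≥ S² + 2S·us²` (the note's cross lemma). -/
theorem G_on_cross_53 (A₁ A₂ A₃ A₄ A₅ B₁ B₂ B₃ u₁ u₂ u₃ u₄ u₅ v₁ v₂ v₃ As us : ℝ)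
    (hA : A₁ + A₂ + A₃ + A₄ + A₅ = B₁ + B₂ + B₃) (hC : u₁ + u₂ + u₃ + u₄ + u₅ = v₁ + v₂ + v₃)
    (hP2 : ((A₁ * u₁ ^ 2 + A₂ * u₂ ^ 2 + A₃ * u₃ ^ 2 + A₄ * u₄ ^ 2 + A₅ * u₅ ^ 2) - (B₁ * v₁ ^ 2 + B₂ * v₂ ^ 2 + B₃ * v₃ ^ 2)) = 0)
    (hP4 : ((u₁ ^ 3 + u₂ ^ 3 + u₃ ^ 3 + u₄ ^ 3 + u₅ ^ 3) - (v₁ ^ 3 + v₂ ^ 3 + v₃ ^ 3)) = 0)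
    (hX₁ : (A₁ - As) ^ 2 = (u₁ - us) ^ 2) (hX₂ : (A₂ - As) ^ 2 = (u₂ - us) ^ 2) (hX₃ : (A₃ - As) ^ 2 = (u₃ - us) ^ 2) (hX₄ : (A₄ - As) ^ 2 = (u₄ - us) ^ 2) (hX₅ : (A₅ - As) ^ 2 = (u₅ - us) ^ 2) (hY₁ : (As - B₁) ^ 2 = (v₁ - us) ^ 2) (hY₂ : (As - B₂) ^ 2 = (v₂ - us) ^ 2) (hY₃ : (As - B₃) ^ 2 = (v₃ - us) ^ 2) :
    (1 / 2) * ((A₁ ^ 2 + A₂ ^ 2 + A₃ ^ 2 + A₄ ^ 2 + A₅ ^ 2) - (B₁ ^ 2 + B₂ ^ 2 + B₃ ^ 2)) * ((u₁ ^ 2 + u₂ ^ 2 + u₃ ^ 2 + u₄ ^ 2 + u₅ ^ 2) - (v₁ ^ 2 + v₂ ^ 2 + v₃ ^ 2))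
        + ((A₁ * u₁ + A₂ * u₂ + A₃ * u₃ + A₄ * u₄ + A₅ * u₅) - (B₁ * v₁ + B₂ * v₂ + B₃ * v₃)) ^ 2
        - 3 * ((A₁ ^ 2 * u₁ ^ 2 + A₂ ^ 2 * u₂ ^ 2 + A₃ ^ 2 * u₃ ^ 2 + A₄ ^ 2 * u₄ ^ 2 + A₅ ^ 2 * u₅ ^ 2) - (B₁ ^ 2 * v₁ ^ 2 + B₂ ^ 2 * v₂ ^ 2 + B₃ ^ 2 * v₃ ^ 2))
      + (3 * ((u₁ ^ 4 + u₂ ^ 4 + u₃ ^ 4 + u₄ ^ 4 + u₅ ^ 4) - (v₁ ^ 4 + v₂ ^ 4 + v₃ ^ 4)) - (3 / 2) * ((u₁ ^ 2 + u₂ ^ 2 + u₃ ^ 2 + u₄ ^ 2 + u₅ ^ 2) - (v₁ ^ 2 + v₂ ^ 2 + v₃ ^ 2)) ^ 2)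
      = (u₁ * (A₁ - As) + u₂ * (A₂ - As) + u₃ * (A₃ - As) + u₄ * (A₄ - As) + u₅ * (A₅ - As) + v₁ * (As - B₁) + v₂ * (As - B₂) + v₃ * (As - B₃)) ^ 2
        + (((u₁ ^ 2 + u₂ ^ 2 + u₃ ^ 2 + u₄ ^ 2 + u₅ ^ 2) - (v₁ ^ 2 + v₂ ^ 2 + v₃ ^ 2)) / 2) * ((A₁ - As) + (A₂ - As) + (A₃ - As) + (A₄ - As) + (A₅ - As) + (As - B₁) + (As - B₂) + (As - B₃)) ^ 2
        - ((u₁ ^ 2 + u₂ ^ 2 + u₃ ^ 2 + u₄ ^ 2 + u₅ ^ 2) - (v₁ ^ 2 + v₂ ^ 2 + v₃ ^ 2)) ^ 2 - 2 * ((u₁ ^ 2 + u₂ ^ 2 + u₃ ^ 2 + u₄ ^ 2 + u₅ ^ 2) - (v₁ ^ 2 + v₂ ^ 2 + v₃ ^ 2)) * us ^ 2 := by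
  linear_combination ((((u₁ ^ 2 + u₂ ^ 2 + u₃ ^ 2 + u₄ ^ 2 + u₅ ^ 2) - (v₁ ^ 2 + v₂ ^ 2 + v₃ ^ 2)) * ((A₁ + A₂ + A₃ + A₄ + A₅) - (B₁ + B₂ + B₃)) - 3 * ((A₁ * u₁ ^ 2 + A₂ * u₂ ^ 2 + A₃ * u₃ ^ 2 + A₄ * u₄ ^ 2 + A₅ * u₅ ^ 2) - (B₁ * v₁ ^ 2 + B₂ * v₂ ^ 2 + B₃ * v₃ ^ 2))) - 3 * ((A₁ - As) + (A₂ - As) + (A₃ - As) + (A₄ - As) + (A₅ - As) + (As - B₁) + (As - B₂) + (As - B₃)) * (((u₁ ^ 2 + u₂ ^ 2 + u₃ ^ 2 + u₄ ^ 2 + u₅ ^ 2) - (v₁ ^ 2 + v₂ ^ 2 + v₃ ^ 2)) / 2)) * hA + ((2 * As * ((A₁ * u₁ + A₂ * u₂ + A₃ * u₃ + A₄ * u₄ + A₅ * u₅) - (B₁ * v₁ + B₂ * v₂ + B₃ * v₃)) - As ^ 2 * ((u₁ + u₂ + u₃ + u₄ + u₅) - (v₁ + v₂ + v₃))) - (us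 * ((u₁ ^ 2 + u₂ ^ 2 + u₃ ^ 2 + u₄ ^ 2 + u₅ ^ 2) - (v₁ ^ 2 + v₂ ^ 2 + v₃ ^ 2)))) * hC + (3 * ((A₁ - As) + (A₂ - As) + (A₃ - As) + (A₄ - As) + (A₅ - As) + (As - B₁) + (As - B₂) + (As - B₃))) * hP2 + (6 * us) * hP4 + (-(3 * (u₁ ^ 2 - ((u₁ ^ 2 + u₂ ^ 2 + u₃ ^ 2 + u₄ ^ 2 + u₅ ^ 2) - (v₁ ^ 2 + v₂ ^ 2 + v₃ ^ 2)) / 2) + ((u₁ ^ 2 + u₂ ^ 2 + u₃ ^ 2 + u₄ ^ 2 + u₅ ^ 2) - (v₁ ^ 2 + v₂ ^ 2 + v₃ ^ 2)))) * hX₁ + (-(3 * (u₂ ^ 2 - ((u₁ ^ 2 + u₂ ^ 2 + u₃ ^ 2 + u₄ ^ 2 + u₅ ^ 2) - (v₁ ^ 2 + v₂ ^ 2 + v₃ ^ 2)) / 2) + ((u₁ ^ 2 + u₂ ^ 2 + u₃ ^ 2 + u₄ ^ 2 + u₅ ^ 2) - (v₁ ^ 2 + v₂ ^ 2 + v₃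 ^ 2)))) * hX₂ + (-(3 * (u₃ ^ 2 - ((u₁ ^ 2 + u₂ ^ 2 + u₃ ^ 2 + u₄ ^ 2 + u₅ ^ 2) - (v₁ ^ 2 + v₂ ^ 2 + v₃ ^ 2)) / 2) + ((u₁ ^ 2 + u₂ ^ 2 + u₃ ^ 2 + u₄ ^ 2 + u₅ ^ 2) - (v₁ ^ 2 + v₂ ^ 2 + v₃ ^ 2)))) * hX₃ + (-(3 * (u₄ ^ 2 - ((u₁ ^ 2 + u₂ ^ 2 + u₃ ^ 2 + u₄ ^ 2 + u₅ ^ 2) - (v₁ ^ 2 + v₂ ^ 2 + v₃ ^ 2)) / 2) + ((u₁ ^ 2 + u₂ ^ 2 + u₃ ^ 2 + u₄ ^ 2 + u₅ ^ 2) - (v₁ ^ 2 + v₂ ^ 2 + v₃ ^ 2)))) * hX₄ + (-(3 * (u₅ ^ 2 - ((u₁ ^ 2 + u₂ ^ 2 + u₃ ^ 2 + u₄ ^ 2 + u₅ ^ 2) - (v₁ ^ 2 + v₂ ^ 2 + v₃ ^ 2)) / 2) + ((u₁ ^ 2 + u₂ ^ 2 + u₃ ^ 2 + u₄ ^ 2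 + u₅ ^ 2) - (v₁ ^ 2 + v₂ ^ 2 + v₃ ^ 2)))) * hX₅ + (3 * (v₁ ^ 2 - ((u₁ ^ 2 + u₂ ^ 2 + u₃ ^ 2 + u₄ ^ 2 + u₅ ^ 2) - (v₁ ^ 2 + v₂ ^ 2 + v₃ ^ 2)) / 2) + ((u₁ ^ 2 + u₂ ^ 2 + u₃ ^ 2 + u₄ ^ 2 + u₅ ^ 2) - (v₁ ^ 2 + v₂ ^ 2 + v₃ ^ 2))) * hY₁ + (3 * (v₂ ^ 2 - ((u₁ ^ 2 + u₂ ^ 2 + u₃ ^ 2 + u₄ ^ 2 + u₅ ^ 2) - (v₁ ^ 2 + v₂ ^ 2 + v₃ ^ 2)) / 2) + ((u₁ ^ 2 + u₂ ^ 2 + u₃ ^ 2 + u₄ ^ 2 + u₅ ^ 2) - (v₁ ^ 2 + v₂ ^ 2 + v₃ ^ 2))) * hY₂ + (3 * (v₃ ^ 2 - ((u₁ ^ 2 + u₂ ^ 2 + u₃ ^ 2 + u₄ ^ 2 + u₅ ^ 2) - (v₁ ^ 2 + v₂ ^ 2 + v₃ ^ 2)) / 2) + ((u₁ ^ 2 +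 u₂ ^ 2 + u₃ ^ 2 + u₄ ^ 2 + u₅ ^ 2) - (v₁ ^ 2 + v₂ ^ 2 + v₃ ^ 2))) * hY₃

end Summit.HodgeConjecture.HodgeConjecture.WeilClassTestFormatFiveThreeVertexGauge
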